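import Summits.KontsevichZagierPeriods.Zeta5Search.LaiSweepShard

/-!
# `κ₃` sweep certificate — shard file 088 of 127 (shards 616–622 of 889)

HONEST FRAMING. Systematic search; no irrationality claim unless certified. This file only checks,
by `decide +kernel`, shards 616–622 of the order-cell sweep of the `κ₃` point `(74, 2180, 444; δ74)`
(engine `LaiSweepEngine`, soundness `LaiSweepJump/Free/Eval/Shard/Kappa3`; a shard is `⟨regime, n,
p, q, p', q', Lo, Up⟩`: `n` cells from `p/q` to `p'/q'` with integer rate sums in `[Lo, Up]`, `K =
128`, `D = 2^40`). It draws NO conclusion: only the capstone `LaiKappa3SweepCert`, which needs all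
127 shard files, does. Kernel cost of this file ≈ 560 cells × 0.3 s.
-/

namespace Summit.KontsevichZagierPeriods.Zeta5Search.Sweep

set_option maxHeartbeats 100000000 in
/-- Shard 616: 80 cells of regime B from `157/239` to `129/196`.
[cite: Lai2024BallRivoal, §4 Lemma 4.3] -/
theorem shard616 :
    Shard.check 128 (2^40)
      ⟨true, 80, 157, 239, 129, 196, 12535378455206, 17301790687490⟩ = true := by
  decide +kernel

set_option maxHeartbeats 100000000 in
/-- Shard 617: 80 cells of regime B from `129/196` to `792/1201`.
[cite: Lai2024BallRivoal, §4 Lemma 4.3] -/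
theorem shard617 :
    Shard.check 128 (2^40)
      ⟨true, 80, 129, 196, 792, 1201, 12793613426531, 17676793390465⟩ = true := by
  decide +kernel

set_option maxHeartbeats 100000000 in
/-- Shard 618: 80 cells of regime B from `792/1201` to `183/277`.
[cite: Lai2024BallRivoal, §4 Lemma 4.3] -/
theorem shard618 :
    Shard.check 128 (2^40)
      ⟨true, 80, 792, 1201, 183, 277, 11910430723441, 16473408588234⟩ = true := by
  decide +kernel

set_option maxHeartbeats 100000000 in
/-- Shard 619: 80 cells of regime B from `183/277` to `233/352`.
[cite: Lai2024BallRivoal, §4 Lemma 4.3] -/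
theorem shard619 :
    Shard.check 128 (2^40)
      ⟨true, 80, 183, 277, 233, 352, 12710901691702, 17598569011527⟩ = true := by
  decide +kernel

set_option maxHeartbeats 100000000 in
/-- Shard 620: 80 cells of regime B from `233/352` to `63/95`.
[cite: Lai2024BallRivoal, §4 Lemma 4.3] -/
theorem shard620 :
    Shard.check 128 (2^40)
      ⟨true, 80, 233, 352, 63, 95, 12138537389107, 16823533563513⟩ = true := by
  decide +kernel

set_option maxHeartbeats 100000000 in
/-- Shard 621: 80 cells of regime B from `63/95` to `95/143`.
[cite: Lai2024BallRivoal, §4 Lemma 4.3] -/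
theorem shard621 :
    Shard.check 128 (2^40)
      ⟨true, 80, 63, 95, 95, 143, 11645337772866, 16156014711666⟩ = true := by
  decide +kernel

set_option maxHeartbeats 100000000 in
/-- Shard 622: 80 cells of regime B from `95/143` to `187/281`.
[cite: Lai2024BallRivoal, §4 Lemma 4.3] -/
theorem shard622 :
    Shard.check 128 (2^40)
      ⟨true, 80, 95, 143, 187, 281, 11298453728775, 15689811825975⟩ = true := by
  decide +kernel

/-- The checked shards of this file, in order. [folklore] -/
def shards088 : List (CheckedShard 128 (2^40)) :=
  [⟨_, shard616⟩, ⟨_, shard617⟩, ⟨_, shard618⟩, ⟨_, shard619⟩, ⟨_, shard620⟩,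
    ⟨_, shard621⟩, ⟨_, shard622⟩]

end Summit.KontsevichZagierPeriods.Zeta5Search.Sweep
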